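import Literature.NumberTheory.Sieve.ParityWave0LargeSieveProofs
import HarnessLib

/-!
# The large sieve in integral form (mean values of exponential sums with well-spaced frequencies)

Topic `Literature/NumberTheory/Sieve`. For a finite family of real frequencies `γ_r`, pairwise
`δ`-spaced *on the line* (`|γ_r − γ_s| ≥ δ` for `r ≠ s`), complex coefficients `c_r` and any
interval of length `L ≥ 0`,

  `∫_{y₀}^{y₀+L} |∑_r c_r e(y γ_r)|² dy ≤ (L + δ⁻¹) ∑_r |c_r|²`     (`e(t) = exp(2πit)`),

(`Literature.NumberTheory.Sieve.largeSieve_integral`). This is the continuous ("mean value")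
form of the large sieve with the sharp constant: Montgomery, *The analytic principle of the large
sieve*, §6, Corollary 3 (p. 557: `∫_0^T |∑ a_r e^{iλ_r t}|² dt = (T + 2πθδ⁻¹)∑|a_r|²`, `|θ| ≤ 1`,
for `δ`-spaced `λ_r`; with `λ_r = 2πγ_r` the constant `2πδ⁻¹` becomes `δ⁻¹`), originally
Montgomery–Vaughan, *Hilbert's inequality* (1974), Corollary 2. Only the upper bound is proved here.

## The argument (transfer from the discrete dual large sieve)

The tree already proves the dual large sieve modulo one with the crude constant
(`Literature.NumberTheory.Sieve.LargeSieveMV.largeSieve_dual`, Montgomery 1978, (6) and Cor. 2):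
for points `x_r` that are `δ'`-spaced modulo `1`,
`∑_{M<n≤M+N} |∑_r c_r e(n x_r)|² ≤ (N + δ'⁻¹ + 3/2) ∑_r |c_r|²`.
Given `δ`-spaced reals `γ_r` lying in a set of diameter `≤ B`, the dilated points `x_r = γ_r/K`
are `δ/K`-spaced modulo `1` as soon as `K ≥ B + δ` (`sep_div_of_sep`). Writing
`g(y) = ∑_r c_r e(yγ_r)`, the dual inequality applied to the coefficients `c_r e(uγ_r)` reads
`∑_{0≤m<N} |g(u + m/K)|² ≤ (N + K/δ + 3/2) ∑|c_r|²` for every shift `u`; integrating over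
`u ∈ [0, 1/K]` and reassembling the pieces `[m/K, (m+1)/K]` gives
`∫_0^{N/K} |g|² ≤ (N/K + δ⁻¹ + 3/(2K)) ∑|c_r|²`, whence with `N = ⌈LK⌉`
`∫_0^L |g|² ≤ (L + δ⁻¹ + 5/(2K)) ∑|c_r|²` for all large `K`, and `K → ∞` gives the claim (the `3/2`
of the crude constant dies, the sharp `δ⁻¹` survives). A shift `y ↦ y + y₀` (absorbed into the
coefficients, `|c_r e(y₀γ_r)| = |c_r|`) gives the general interval.

## Main results

* `largeSieve_integral` — the inequality above (any `y₀`, `L ≥ 0`).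
* `largeSieve_integral_one` — the case `c_r = 1`: `∫ |∑_r e(yγ_r)|² ≤ (L + δ⁻¹) · card`.

## References

* [Montgomery1978] H. L. Montgomery, Bull. Amer. Math. Soc. 84 (1978), §6, Cor. 3, p. 557; (6) and
  Cor. 2, p. 556 (the discrete dual form used as input).
* [MontgomeryVaughan1974] H. L. Montgomery, R. C. Vaughan, *Hilbert's inequality*, J. London Math.
  Soc. (2) 8 (1974), 73–82, Corollary 2.
* [Gallagher1970] P. X. Gallagher, Invent. Math. 11 (1970), 329–339 (the weaker form
  `≪ (T + δ⁻¹) ∑|a_r|²`, Lemma 1 there).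
-/

noncomputable section

open Finset Real Complex MeasureTheory
open scoped ComplexConjugate FourierTransform

namespace Literature.NumberTheory.Sieve

namespace LargeSieveMV

open LargeSieve (e e_eq_exp e_add norm_e)

/-! ### Small analytic facts about `e` and exponential sums -/

/-- The exponential sum `y ↦ ∑_r c_r e(y γ_r)` is continuous (`e(t) = exp(2πit)` is). [folklore] -/
theorem continuous_expSum {ι : Type*} [Fintype ι] (γ : ι → ℝ) (c : ι → ℂ) :
    Continuous fun y : ℝ => ∑ r, c r * e (y * γ r) := by
  have he : e = fun t : ℝ => Complex.exp (I * (2 * π * t : ℝ)) := funext e_eq_exp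
  refine continuous_finsetSum _ fun r _ => ?_
  rw [he]
  fun_prop

/-- A shift of the variable is absorbed into the coefficients:
`∑_r c_r e((u + y) γ_r) = ∑_r (c_r e(u γ_r)) e(y γ_r)`. [folklore] -/
theorem expSum_add {ι : Type*} [Fintype ι] (γ : ι → ℝ) (c : ι → ℂ) (u y : ℝ) :
    ∑ r, c r * e ((u + y) * γ r) = ∑ r, (c r * e (u * γ r)) * e (y * γ r) := by
  refine Finset.sum_congr rfl fun r _ => ?_
  rw [add_mul, e_add, mul_assoc]

/-- `|c_r e(u γ_r)| = |c_r|`, summed in squares. [folklore] -/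
theorem sum_norm_sq_mul_e {ι : Type*} [Fintype ι] (γ : ι → ℝ) (c : ι → ℂ) (u : ℝ) :
    ∑ r, ‖c r * e (u * γ r)‖ ^ 2 = ∑ r, ‖c r‖ ^ 2 := by
  refine Finset.sum_congr rfl fun r _ => ?_
  rw [norm_mul, norm_e, mul_one]

/-- Shifting an interval integral to start at `0`: `∫_{y₀}^{y₀+L} F = ∫_0^L F(· + y₀)`. [folklore] -/
theorem integral_comp_add_right_zero (F : ℝ → ℝ) (y₀ L : ℝ) :
    ∫ y in y₀..(y₀ + L), F y = ∫ y in (0 : ℝ)..L, F (y + y₀) := by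
  rw [intervalIntegral.integral_comp_add_right F y₀, zero_add, add_comm]

/-! ### Dilation: `δ`-spaced reals become `δ/K`-spaced points modulo one -/

/-- If the reals `γ_r` are pairwise `δ`-spaced and lie in a set of diameter `≤ B`, and
`K ≥ B + δ`, `K > 0`, then the points `γ_r / K` are `δ/K`-spaced modulo `1`.
[cite: Montgomery1978, p. 559, note added in proof (the dilation device)] -/
theorem sep_div_of_sep {ι : Type*} (γ : ι → ℝ) {δ B K : ℝ} (hK : 0 < K) (hKB : B + δ ≤ K)
    (hdiam : ∀ r s, |γ r - γ s| ≤ B) (hsep : ∀ r s, r ≠ s → δ ≤ |γ r - γ s|) :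
    ∀ r s, r ≠ s → ∀ k : ℤ, δ / K ≤ |γ r / K - γ s / K - k| := by
  intro r s hrs k
  have hγ : γ r / K - γ s / K - k = (γ r - γ s - k * K) / K := by
    field_simp
  rw [hγ, abs_div, abs_of_pos hK, div_le_div_iff_of_pos_right hK]
  by_cases hk : k = 0
  · subst hk
    simpa using hsep r s hrs
  · -- `|γ_r - γ_s - kK| ≥ |k| K - |γ_r - γ_s| ≥ K - B ≥ δ`
    have hk1 : (1 : ℝ) ≤ |(k : ℝ)| := by
      rw [← Int.cast_abs]
      exact_mod_cast Int.one_le_abs hk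
    have h1 : |(k : ℝ) * K| - |γ r - γ s| ≤ |γ r - γ s - k * K| := by
      have := abs_sub_abs_le_abs_sub ((k : ℝ) * K) (γ r - γ s)
      rw [abs_sub_comm ((k : ℝ) * K)] at this
      exact this
    have h2 : K ≤ |(k : ℝ) * K| := by
      rw [abs_mul, abs_of_pos hK]
      nlinarith
    have h3 := hdiam r s
    linarith

/-! ### The discrete input, reindexed -/

/-- The dual large sieve (`largeSieve_dual`) along the arithmetic progression `u + m/K`,
`0 ≤ m < N`: for `δ`-spaced `γ_r` of diameter `≤ B` and `K ≥ B + δ`,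
`∑_{m<N} |∑_r c_r e((u + m/K) γ_r)|² ≤ (N + K/δ + 3/2) ∑_r |c_r|²`.
[cite: Montgomery1978, (6) p. 551 and Cor. 2 p. 556] -/
theorem sum_normSq_expSum_progression_le {ι : Type*} [Fintype ι] [DecidableEq ι] (γ : ι → ℝ)
    {δ B K : ℝ} (hδ : 0 < δ) (hK : 0 < K) (hKB : B + δ ≤ K)
    (hdiam : ∀ r s, |γ r - γ s| ≤ B) (hsep : ∀ r s, r ≠ s → δ ≤ |γ r - γ s|)
    (c : ι → ℂ) (u : ℝ) (N : ℕ) :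
    ∑ m ∈ Finset.range N, ‖∑ r, c r * e ((u + m / K) * γ r)‖ ^ 2 ≤
      ((N : ℝ) + (K / δ + 3 / 2)) * ∑ r, ‖c r‖ ^ 2 := by
  have hsepK := sep_div_of_sep γ hK hKB hdiam hsep
  have hδK : 0 < δ / K := div_pos hδ hK
  -- coefficients absorbing the shift `u - 1/K`
  set c' : ι → ℂ := fun r => c r * e ((u - 1 / K) * γ r) with hc'
  have hdual := largeSieve_dual (x := fun r => γ r / K) hδK hsepK c' 0 N
  rw [sum_norm_sq_mul_e, inv_div] at hdual
  simp only [zero_add] at hdual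
  -- reindex `n ∈ Ioc 0 N` (integers) as `m + 1`, `m ∈ range N`
  have hre : ∑ m ∈ Finset.range N, ‖∑ r, c r * e ((u + m / K) * γ r)‖ ^ 2 =
      ∑ n ∈ Ioc (0 : ℤ) (N : ℤ), ‖∑ r, c' r * e (n * (γ r / K))‖ ^ 2 := by
    have himage : Ioc (0 : ℤ) (N : ℤ) = (Finset.range N).image fun m : ℕ => (m : ℤ) + 1 := by
      ext n
      simp only [Finset.mem_Ioc, Finset.mem_image, Finset.mem_range]
      constructor
      · rintro ⟨h0, hN⟩
        refine ⟨(n - 1).toNat, ?_, ?_⟩ <;> omega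
      · rintro ⟨m, hm, rfl⟩
        omega
    rw [himage, Finset.sum_image (by
      intro a _ b _ h
      have : (a : ℤ) = b := by linarith
      exact_mod_cast this)]
    refine Finset.sum_congr rfl fun m _ => ?_
    congr 2
    refine Finset.sum_congr rfl fun r _ => ?_
    rw [hc', mul_assoc, ← e_add]
    congr 2
    push_cast
    field_simp
    ring
  rw [hre]
  exact hdual

/-! ### From the progression to the integral -/

/-- Reassembling `[0, N/K]` from the pieces `[m/K, (m+1)/K]`: for continuous `h`,
`∫_0^{N/K} h = ∫_0^{1/K} ∑_{m<N} h(u + m/K) du`. [folklore] -/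
theorem integral_eq_integral_sum_progression {h : ℝ → ℝ} (hh : Continuous h) {K : ℝ}
    (hK : 0 < K) (N : ℕ) :
    ∫ y in (0 : ℝ)..(N / K), h y = ∫ u in (0 : ℝ)..(1 / K), ∑ m ∈ Finset.range N, h (u + m / K) := by
  have hsum : ∫ u in (0 : ℝ)..(1 / K), ∑ m ∈ Finset.range N, h (u + m / K) =
      ∑ m ∈ Finset.range N, ∫ u in (0 : ℝ)..(1 / K), h (u + m / K) :=
    intervalIntegral.integral_finsetSum fun (m : ℕ) _ =>
      (by fun_prop : Continuous fun u : ℝ => h (u + m / K)).intervalIntegrable _ _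
  have hpieces : ∀ m ∈ Finset.range N, ∫ u in (0 : ℝ)..(1 / K), h (u + m / K) =
      ∫ y in ((m : ℝ) / K)..(((m + 1 : ℕ) : ℝ) / K), h y := by
    intro m _
    rw [intervalIntegral.integral_comp_add_right h ((m : ℝ) / K)]
    congr 1
    · ring
    · push_cast; field_simp; ring
  have hadj : ∑ m ∈ Finset.range N, ∫ y in ((m : ℝ) / K)..(((m + 1 : ℕ) : ℝ) / K), h y =
      ∫ y in (((0 : ℕ) : ℝ) / K)..((N : ℝ) / K), h y :=
    intervalIntegral.sum_integral_adjacent_intervals (a := fun m : ℕ => (m : ℝ) / K)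
      fun m _ => hh.intervalIntegrable _ _
  rw [hsum, Finset.sum_congr rfl hpieces, hadj]
  simp

/-- The integral over `[0, N/K]` is controlled by the progression sums:
`∫_0^{N/K} |g|² ≤ (N + K/δ + 3/2)/K · ∑|c_r|²`. [cite: Montgomery1978, §6 Cor. 3, p. 557] -/
theorem integral_normSq_expSum_le_aux {ι : Type*} [Fintype ι] [DecidableEq ι] (γ : ι → ℝ)
    {δ B K : ℝ} (hδ : 0 < δ) (hK : 0 < K) (hKB : B + δ ≤ K)
    (hdiam : ∀ r s, |γ r - γ s| ≤ B) (hsep : ∀ r s, r ≠ s → δ ≤ |γ r - γ s|)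
    (c : ι → ℂ) (N : ℕ) :
    ∫ y in (0 : ℝ)..(N / K), ‖∑ r, c r * e (y * γ r)‖ ^ 2 ≤
      ((N : ℝ) + (K / δ + 3 / 2)) / K * ∑ r, ‖c r‖ ^ 2 := by
  set g : ℝ → ℂ := fun y => ∑ r, c r * e (y * γ r) with hg
  have hgc : Continuous g := continuous_expSum γ c
  have hh : Continuous fun y => ‖g y‖ ^ 2 := by fun_prop
  rw [integral_eq_integral_sum_progression hh hK N]
  have hbound : ∀ u, ∑ m ∈ Finset.range N, ‖g (u + m / K)‖ ^ 2 ≤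
      ((N : ℝ) + (K / δ + 3 / 2)) * ∑ r, ‖c r‖ ^ 2 := fun u =>
    sum_normSq_expSum_progression_le γ hδ hK hKB hdiam hsep c u N
  have hK1 : (0 : ℝ) ≤ 1 / K := by positivity
  calc ∫ u in (0 : ℝ)..(1 / K), ∑ m ∈ Finset.range N, ‖g (u + m / K)‖ ^ 2
      ≤ ∫ _ in (0 : ℝ)..(1 / K), ((N : ℝ) + (K / δ + 3 / 2)) * ∑ r, ‖c r‖ ^ 2 := by
        have hsc : Continuous fun u : ℝ => ∑ m ∈ Finset.range N, ‖g (u + m / K)‖ ^ 2 := by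
          fun_prop
        exact intervalIntegral.integral_mono_on hK1 (hsc.intervalIntegrable _ _)
          intervalIntegrable_const fun u _ => hbound u
    _ = ((N : ℝ) + (K / δ + 3 / 2)) / K * ∑ r, ‖c r‖ ^ 2 := by
        rw [intervalIntegral.integral_const]
        simp only [sub_zero, smul_eq_mul]
        field_simp

/-- For all large `K`: `∫_0^L |g|² ≤ (L + δ⁻¹) ∑|c_r|² + (5/2) ∑|c_r|² / K`.
[cite: Montgomery1978, §6 Cor. 3, p. 557] -/
theorem integral_normSq_expSum_le_add_div {ι : Type*} [Fintype ι] [DecidableEq ι] (γ : ι → ℝ)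
    {δ B K : ℝ} (hδ : 0 < δ) (hK : 0 < K) (hKB : B + δ ≤ K)
    (hdiam : ∀ r s, |γ r - γ s| ≤ B) (hsep : ∀ r s, r ≠ s → δ ≤ |γ r - γ s|)
    (c : ι → ℂ) {L : ℝ} (hL : 0 ≤ L) :
    ∫ y in (0 : ℝ)..L, ‖∑ r, c r * e (y * γ r)‖ ^ 2 ≤
      (L + δ⁻¹) * ∑ r, ‖c r‖ ^ 2 + 5 / 2 * (∑ r, ‖c r‖ ^ 2) / K := by
  set C : ℝ := ∑ r, ‖c r‖ ^ 2 with hC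
  have hC0 : 0 ≤ C := Finset.sum_nonneg fun r _ => sq_nonneg _
  set N : ℕ := ⌈L * K⌉₊ with hN
  have hNge : L * K ≤ N := Nat.le_ceil _
  have hNle : (N : ℝ) ≤ L * K + 1 := (Nat.ceil_lt_add_one (by positivity)).le
  have hLN : L ≤ N / K := by rw [le_div_iff₀ hK]; exact hNge
  have hcont : Continuous fun y => ‖∑ r, c r * e (y * γ r)‖ ^ 2 := by
    have := continuous_expSum γ c
    fun_prop
  -- `∫_0^L ≤ ∫_0^{N/K}`
  have hmono : ∫ y in (0 : ℝ)..L, ‖∑ r, c r * e (y * γ r)‖ ^ 2 ≤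
      ∫ y in (0 : ℝ)..(N / K), ‖∑ r, c r * e (y * γ r)‖ ^ 2 := by
    have hsplit : (∫ y in (0 : ℝ)..L, ‖∑ r, c r * e (y * γ r)‖ ^ 2) +
        ∫ y in L..(N / K), ‖∑ r, c r * e (y * γ r)‖ ^ 2 =
        ∫ y in (0 : ℝ)..(N / K), ‖∑ r, c r * e (y * γ r)‖ ^ 2 :=
      intervalIntegral.integral_add_adjacent_intervals (hcont.intervalIntegrable _ _)
        (hcont.intervalIntegrable _ _)
    have : 0 ≤ ∫ y in L..(N / K), ‖∑ r, c r * e (y * γ r)‖ ^ 2 :=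
      intervalIntegral.integral_nonneg hLN fun y _ => sq_nonneg _
    linarith
  refine hmono.trans ((integral_normSq_expSum_le_aux γ hδ hK hKB hdiam hsep c N).trans ?_)
  rw [← hC]
  have hK0 : K ≠ 0 := hK.ne'
  have key : ((N : ℝ) + (K / δ + 3 / 2)) / K ≤ (L + δ⁻¹) + 5 / 2 / K := by
    rw [div_le_iff₀ hK]
    have : ((L + δ⁻¹) + 5 / 2 / K) * K = L * K + K / δ + 5 / 2 := by
      field_simp
    rw [this]
    linarith
  calc ((N : ℝ) + (K / δ + 3 / 2)) / K * C ≤ ((L + δ⁻¹) + 5 / 2 / K) * C :=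
        mul_le_mul_of_nonneg_right key hC0
    _ = (L + δ⁻¹) * C + 5 / 2 * C / K := by ring

end LargeSieveMV

open LargeSieve (e e_add norm_e)
open LargeSieveMV

/-- **The large sieve in integral form (sharp constant).** If the reals `γ_r` (`r` in a finite
type) are pairwise `δ`-spaced, `δ > 0`, then for all complex `c_r`, every `y₀` and every `L ≥ 0`,
`∫_{y₀}^{y₀+L} |∑_r c_r e(y γ_r)|² dy ≤ (L + δ⁻¹) ∑_r |c_r|²` (`e(t) = exp(2πit)`).
This is the upper-bound half of Montgomery 1978, §6, Corollary 3 (stated there for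
`e^{iλ_r t}` with `δ`-spaced `λ_r` and the constant `T + 2πθδ⁻¹`, `|θ| ≤ 1`; here `λ_r = 2πγ_r`),
due to Montgomery–Vaughan (1974, Cor. 2). Proved by transfer from the discrete dual large sieve
modulo one (`LargeSieveMV.largeSieve_dual`) through dilation and averaging over shifts.
[cite: Montgomery1978, §6 Corollary 3, p. 557] -/
theorem largeSieve_integral {ι : Type*} [Fintype ι] (γ : ι → ℝ) {δ : ℝ} (hδ : 0 < δ)
    (hsep : ∀ r s, r ≠ s → δ ≤ |γ r - γ s|) (c : ι → ℂ) (y₀ : ℝ) {L : ℝ} (hL : 0 ≤ L) :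
    ∫ y in y₀..(y₀ + L), ‖∑ r, c r * e (y * γ r)‖ ^ 2 ≤ (L + δ⁻¹) * ∑ r, ‖c r‖ ^ 2 := by
  classical
  -- reduce to `y₀ = 0` by absorbing the shift into the coefficients
  set c' : ι → ℂ := fun r => c r * e (y₀ * γ r) with hc'
  have hshift : ∫ y in y₀..(y₀ + L), ‖∑ r, c r * e (y * γ r)‖ ^ 2 =
      ∫ y in (0 : ℝ)..L, ‖∑ r, c' r * e (y * γ r)‖ ^ 2 := by
    rw [show (∫ y in y₀..(y₀ + L), ‖∑ r, c r * e (y * γ r)‖ ^ 2) =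
        ∫ y in (0 : ℝ)..L, ‖∑ r, c r * e ((y + y₀) * γ r)‖ ^ 2 from
      integral_comp_add_right_zero (fun y => ‖∑ r, c r * e (y * γ r)‖ ^ 2) y₀ L]
    refine intervalIntegral.integral_congr fun y _ => ?_
    rw [add_comm y y₀, expSum_add]
  rw [hshift, ← sum_norm_sq_mul_e γ c y₀]
  -- a diameter bound for the frequencies
  set B : ℝ := 2 * ∑ r, |γ r| with hB
  have hdiam : ∀ r s, |γ r - γ s| ≤ B := by
    intro r s
    have hr : |γ r| ≤ ∑ t, |γ t| :=
      Finset.single_le_sum (f := fun t => |γ t|) (fun t _ => abs_nonneg _) (Finset.mem_univ r)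
    have hs : |γ s| ≤ ∑ t, |γ t| :=
      Finset.single_le_sum (f := fun t => |γ t|) (fun t _ => abs_nonneg _) (Finset.mem_univ s)
    calc |γ r - γ s| ≤ |γ r| + |γ s| := abs_sub _ _
      _ ≤ B := by rw [hB]; linarith
  have hB0 : 0 ≤ B := by
    rw [hB]; exact mul_nonneg (by norm_num) (Finset.sum_nonneg fun r _ => abs_nonneg _)
  set C : ℝ := ∑ r, ‖c' r‖ ^ 2 with hC
  have hC0 : 0 ≤ C := Finset.sum_nonneg fun r _ => sq_nonneg _
  -- the bound with an extra `(5/2) C / K` for every positive integer `K`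
  refine le_of_forall_le_add_div (C := 5 / 2 * C) (by positivity) fun K hKpos => ?_
  -- enlarge `K` to `K' = K ⌈B + δ⌉ ≥ B + δ`
  set K₀ : ℕ := ⌈B + δ⌉₊ with hK₀
  have hK₀1 : 1 ≤ K₀ := Nat.one_le_iff_ne_zero.2 (Nat.ceil_pos.2 (by positivity)).ne'
  set K' : ℝ := (K : ℝ) * K₀ with hK'
  have hKr : (0 : ℝ) < K := by exact_mod_cast hKpos
  have hK₀r : (1 : ℝ) ≤ K₀ := by exact_mod_cast hK₀1
  have hK'pos : 0 < K' := by positivity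
  have hK'ge : B + δ ≤ K' := by
    have h1 : B + δ ≤ K₀ := Nat.le_ceil _
    have h2 : (K₀ : ℝ) ≤ K' := by
      rw [hK']
      have : (1 : ℝ) ≤ K := by exact_mod_cast hKpos
      nlinarith
    linarith
  have hKK' : (K : ℝ) ≤ K' := by rw [hK']; nlinarith
  have hmain := integral_normSq_expSum_le_add_div γ hδ hK'pos hK'ge hdiam hsep c' hL
  have hdiv : 5 / 2 * C / K' ≤ 5 / 2 * C / K :=
    div_le_div_of_nonneg_left (by positivity) hKr hKK'
  linarith

/-- The case of unit coefficients: for pairwise `δ`-spaced reals `γ_r`,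
`∫_{y₀}^{y₀+L} |∑_r e(y γ_r)|² dy ≤ (L + δ⁻¹) · #ι`. [cite: Montgomery1978, §6 Corollary 3, p. 557] -/
theorem largeSieve_integral_one {ι : Type*} [Fintype ι] (γ : ι → ℝ) {δ : ℝ} (hδ : 0 < δ)
    (hsep : ∀ r s, r ≠ s → δ ≤ |γ r - γ s|) (y₀ : ℝ) {L : ℝ} (hL : 0 ≤ L) :
    ∫ y in y₀..(y₀ + L), ‖∑ r, e (y * γ r)‖ ^ 2 ≤ (L + δ⁻¹) * Fintype.card ι := by
  have h := largeSieve_integral γ hδ hsep (fun _ => 1) y₀ hL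
  simpa using h

end Literature.NumberTheory.Sieve
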